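import Mathlib
import Literature.NumberTheory.EllipticCurves.Smith2016.CongruentNumberGenusDeterminantHolds

/-!
# Pointed decomposition sums regrouped over the distinguished block (bookkeeping for Smith 2016, Thm. 2.2 rows 5b–7b)

The genus sums of Tian–Yuan–Zhang [TianYuanZhang2017, Thm. 1.2] and the right-hand sides of A. Smith's Table 2
[Smith2016CongruentDensity, Thm. 2.2 rows 5(b), 6, 7(a), 7(b)] are sums over the non-ordered decompositions
`n = d₀d₁⋯d_ℓ` of a square-free `n` with ONE or TWO distinguished factors
(`Σ_{d₀d₁ ∣ n, d₀ ≡ 7, d₁ ≡ 3 (8)} g(d₀)g(d₁)ℒ(n/d₀d₁)`, …).  For `n = ∏_{i∈S} pᵢ` (distinct primes) a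
decomposition is a set partition of `S` (`sum_decompositions_eq_setExp` of `CongruentNumberGenusDeterminantHolds`),
and a decomposition WITH A DISTINGUISHED FACTOR `d₀` is a nonempty block `B ⊆ S` (`d₀ = ∏_B pᵢ`) together with a
decomposition of the complementary product.  This file proves the corresponding regrouping identities for
arbitrary weights:
* `sum_decompositions_pointed_eq` — `Σ_{D} Σ_{d₀ ∈ D} φ(d₀) · R(D ∖ d₀) = Σ_{∅ ≠ B ⊆ S} φ(∏_B pᵢ) · Σ_{D′ ∈ decompositions(∏_{S∖B} pᵢ)} R(D′)`
  for any `φ : ℕ → M` and any function `R` of the remaining decomposition;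
* `sum_decompositions_pointed_prod_eq` — the case `R(D′) = ∏_{d ∈ D′} w(d)`;
* `sum_decompositions_twoPointed_prod_eq` — two distinguished factors (ordered, distinct):
  `Σ_D Σ_{d₀} Σ_{d₁ ≠ d₀} φ(d₀) ψ(d₁) ∏_{d ≠ d₀,d₁} w(d) = Σ_{∅≠B} Σ_{∅≠B′ ⊆ S∖B} φ(∏_B p) ψ(∏_{B′} p) Σ_{D′} ∏ w`.
Pure finite combinatorics (Smith's Remark 2.3: "if `d = p_{i₁}⋯p_{i_{r′}}` is a divisor of the odd part of `n` …
`S = {i₁, …, i_{r′}}`").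
-/

namespace Literature.NumberTheory.EllipticCurves.Smith2016

open Finset
open Literature.NumberTheory.EllipticCurves.TianYuanZhang2017

variable {k : ℕ} (p : Fin k → ℕ)

section Pointed

/-- Removing the distinguished factor: if `d₀ ∈ D ∈ decompositions(∏_S pᵢ)` and `B = {i ∈ S : pᵢ ∣ d₀}`, then
`D ∖ d₀` is a decomposition of `∏_{S∖B} pᵢ`. [cite: Smith2016CongruentDensity, §2.1 Remark 2.3] -/
theorem erase_mem_decompositions_sdiff_filter (hp : ∀ i, (p i).Prime) (hinj : Function.Injective p)
    {S : Finset (Fin k)} {D : Finset ℕ} (hD : D ∈ decompositions (∏ i ∈ S, p i)) {d₀ : ℕ} (hd₀ : d₀ ∈ D) :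
    D.erase d₀ ∈ decompositions (∏ i ∈ S \ S.filter (fun i => p i ∣ d₀), p i) := by
  obtain ⟨hsub, hgt, -, -⟩ := mem_decompositions_iff.mp hD
  have hdvd : d₀ ∣ ∏ i ∈ S, p i := (Nat.mem_divisors.mp (hsub hd₀)).1
  have hdB := eq_blockProd_filter_of_dvd p hp hinj S hdvd
  -- a prime index of `d₀`
  have hBne : (S.filter (fun i => p i ∣ d₀)).Nonempty := by
    by_contra h
    rw [not_nonempty_iff_eq_empty] at h
    rw [h, prod_empty] at hdB
    exact absurd hdB (hgt d₀ hd₀).ne'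
  obtain ⟨m, hm⟩ := hBne
  have hmS : m ∈ S := (mem_filter.mp hm).1
  have hmd₀ : p m ∣ d₀ := (mem_filter.mp hm).2
  obtain ⟨d₀', hd₀', hmd₀', huniq, -, -, hrest⟩ := decomposition_blockProd_structure p hp hinj hmS hD
  have he : d₀ = d₀' := huniq d₀ hd₀ hmd₀
  subst he
  have hset : (S.erase m) \ ((S.erase m).filter (fun i => p i ∣ d₀)) = S \ S.filter (fun i => p i ∣ d₀) := by
    ext i
    simp only [mem_sdiff, mem_erase, mem_filter, ne_eq]
    constructor
    · rintro ⟨⟨him, hiS⟩, hnot⟩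
      exact ⟨hiS, fun h => hnot ⟨⟨him, hiS⟩, h.2⟩⟩
    · rintro ⟨hiS, hnot⟩
      refine ⟨⟨fun h => hnot ⟨hiS, h ▸ hmd₀'⟩, hiS⟩, fun h => hnot ⟨hiS, h.2⟩⟩
  rw [← hset]
  exact hrest

/-- Adjoining a distinguished block: for `∅ ≠ B ⊆ S` and `D′ ∈ decompositions(∏_{S∖B} pᵢ)`, `∏_B pᵢ ∉ D′` and
`{∏_B pᵢ} ∪ D′ ∈ decompositions(∏_S pᵢ)`. [cite: Smith2016CongruentDensity, §2.1 Remark 2.3] -/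
theorem insert_blockProd_mem_decompositions' (hp : ∀ i, (p i).Prime) (hinj : Function.Injective p)
    {S B : Finset (Fin k)} (hBS : B ⊆ S) (hB : B.Nonempty) {D' : Finset ℕ}
    (hD' : D' ∈ decompositions (∏ i ∈ S \ B, p i)) :
    (∏ i ∈ B, p i) ∉ D' ∧ insert (∏ i ∈ B, p i) D' ∈ decompositions (∏ i ∈ S, p i) := by
  obtain ⟨m, hm⟩ := hB
  have hB0 : B.erase m ⊆ S.erase m := erase_subset_erase m hBS
  have hset : (S.erase m) \ (B.erase m) = S \ B := by
    ext i
    simp only [mem_sdiff, mem_erase, ne_eq]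
    constructor
    · rintro ⟨⟨him, hiS⟩, hnot⟩
      exact ⟨hiS, fun h => hnot ⟨him, h⟩⟩
    · rintro ⟨hiS, hnot⟩
      exact ⟨⟨fun h => hnot (h ▸ hm), hiS⟩, fun h => hnot h.2⟩
  have hD'' : D' ∈ decompositions (∏ i ∈ (S.erase m) \ (B.erase m), p i) := by rw [hset]; exact hD'
  have h := insert_blockProd_mem_decompositions p hp hinj (hBS hm) hB0 hD''
  rw [insert_erase hm] at h
  exact ⟨h.1, h.2.2⟩

/-- **A pointed decomposition sum regroups over the distinguished block**: for `S ⊆ [k]`, any `φ : ℕ → M` and any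
function `R` of the remaining decomposition,
`Σ_{D ∈ decompositions(∏_S pᵢ)} Σ_{d₀ ∈ D} φ(d₀) · R(D ∖ d₀) = Σ_{∅ ≠ B ⊆ S} φ(∏_B pᵢ) · Σ_{D′ ∈ decompositions(∏_{S∖B} pᵢ)} R(D′)`.
[cite: Smith2016CongruentDensity, §2.1 Remark 2.3 and Table 2 (the sums over divisors d ∣ n with ℒ(n/d))] [cite: TianYuanZhang2017, Thm. 1.2 (non-ordered decompositions with a main block d₀)] -/
theorem sum_decompositions_pointed_eq {M : Type*} [CommSemiring M] (hp : ∀ i, (p i).Prime)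
    (hinj : Function.Injective p) (φ : ℕ → M) (R : Finset ℕ → M) (S : Finset (Fin k)) :
    ∑ D ∈ decompositions (∏ i ∈ S, p i), ∑ d₀ ∈ D, φ d₀ * R (D.erase d₀) =
      ∑ B ∈ S.powerset.filter (fun B => B.Nonempty), φ (∏ i ∈ B, p i) *
        ∑ D ∈ decompositions (∏ i ∈ S \ B, p i), R D := by
  simp_rw [mul_sum]
  rw [sum_sigma', sum_sigma']
  refine sum_bij'
    (fun x _ => ⟨S.filter (fun i => p i ∣ x.2), x.1.erase x.2⟩)
    (fun y _ => ⟨insert (∏ i ∈ y.1, p i) y.2, ∏ i ∈ y.1, p i⟩) ?_ ?_ ?_ ?_ ?_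
  · -- `i` lands in the sigma set
    rintro ⟨D, d₀⟩ hx
    rw [mem_sigma] at hx
    obtain ⟨hD, hd₀⟩ := hx
    dsimp only at hD hd₀ ⊢
    obtain ⟨hsub, hgt, -, -⟩ := mem_decompositions_iff.mp hD
    have hdB := eq_blockProd_filter_of_dvd p hp hinj S (Nat.mem_divisors.mp (hsub hd₀)).1
    rw [mem_sigma, mem_filter, mem_powerset]
    refine ⟨⟨filter_subset _ _, ?_⟩, erase_mem_decompositions_sdiff_filter p hp hinj hD hd₀⟩
    by_contra h
    dsimp only at h
    rw [not_nonempty_iff_eq_empty] at h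
    rw [h, prod_empty] at hdB
    exact absurd hdB (hgt d₀ hd₀).ne'
  · -- `j` lands in the sigma set
    rintro ⟨B, D'⟩ hy
    rw [mem_sigma, mem_filter, mem_powerset] at hy
    dsimp only at hy ⊢
    rw [mem_sigma]
    exact ⟨(insert_blockProd_mem_decompositions' p hp hinj hy.1.1 hy.1.2 hy.2).2, mem_insert_self _ _⟩
  · -- left inverse
    rintro ⟨D, d₀⟩ hx
    rw [mem_sigma] at hx
    obtain ⟨hD, hd₀⟩ := hx
    dsimp only at hD hd₀ ⊢
    obtain ⟨hsub, -, -, -⟩ := mem_decompositions_iff.mp hD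
    have hdB := eq_blockProd_filter_of_dvd p hp hinj S (Nat.mem_divisors.mp (hsub hd₀)).1
    simp only [← hdB, insert_erase hd₀]
  · -- right inverse
    rintro ⟨B, D'⟩ hy
    rw [mem_sigma, mem_filter, mem_powerset] at hy
    dsimp only at hy ⊢
    have hnot := (insert_blockProd_mem_decompositions' p hp hinj hy.1.1 hy.1.2 hy.2).1
    have hB : S.filter (fun i => p i ∣ ∏ j ∈ B, p j) = B := by
      ext i
      rw [mem_filter, prime_dvd_blockProd_iff p hp hinj]
      exact ⟨fun h => h.2, fun h => ⟨hy.1.1 h, h⟩⟩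
    simp only [hB, erase_insert hnot]
  · -- the summands agree
    rintro ⟨D, d₀⟩ hx
    rw [mem_sigma] at hx
    obtain ⟨hD, hd₀⟩ := hx
    dsimp only at hD hd₀ ⊢
    obtain ⟨hsub, -, -, -⟩ := mem_decompositions_iff.mp hD
    have hdB := eq_blockProd_filter_of_dvd p hp hinj S (Nat.mem_divisors.mp (hsub hd₀)).1
    simp only [← hdB]

/-- **Pointed product weights**: `Σ_D Σ_{d₀ ∈ D} φ(d₀) ∏_{d ∈ D∖d₀} w(d) = Σ_{∅≠B⊆S} φ(∏_B pᵢ) Σ_{D′ ∈ decompositions(∏_{S∖B} pᵢ)} ∏_{d∈D′} w(d)`.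
[cite: Smith2016CongruentDensity, Table 2 rows 3, 5(a), 7(a) (Σ_{d | n, d ≡ x (8)} g(d) ℒ(n/d))] -/
theorem sum_decompositions_pointed_prod_eq {M : Type*} [CommSemiring M] (hp : ∀ i, (p i).Prime)
    (hinj : Function.Injective p) (φ w : ℕ → M) (S : Finset (Fin k)) :
    ∑ D ∈ decompositions (∏ i ∈ S, p i), ∑ d₀ ∈ D, φ d₀ * ∏ d ∈ D.erase d₀, w d =
      ∑ B ∈ S.powerset.filter (fun B => B.Nonempty), φ (∏ i ∈ B, p i) *
        ∑ D ∈ decompositions (∏ i ∈ S \ B, p i), ∏ d ∈ D, w d :=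
  sum_decompositions_pointed_eq p hp hinj φ (fun D => ∏ d ∈ D, w d) S

/-- **Two distinguished factors (ordered, distinct)**:
`Σ_D Σ_{d₀ ∈ D} Σ_{d₁ ∈ D∖d₀} φ(d₀) ψ(d₁) ∏_{d ∈ D∖{d₀,d₁}} w(d) = Σ_{∅≠B⊆S} Σ_{∅≠B′⊆S∖B} φ(∏_B pᵢ) ψ(∏_{B′} pᵢ) Σ_{D′ ∈ decompositions(∏_{S∖B∖B′} pᵢ)} ∏_{d∈D′} w(d)`.
[cite: Smith2016CongruentDensity, Table 2 rows 5(b), 6, 7(b) (Σ_{d₀d₁ | n, d₀ ≡ x, d₁ ≡ y (8)} g(d₀)g(d₁) ℒ(n/d₀d₁))] [cite: TianYuanZhang2017, Thm. 1.2 (the second genus sum: d₀ ≡ 5,6,7 and d₁ ≡ 1,2,3 (8))] -/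
theorem sum_decompositions_twoPointed_prod_eq {M : Type*} [CommSemiring M] (hp : ∀ i, (p i).Prime)
    (hinj : Function.Injective p) (φ ψ w : ℕ → M) (S : Finset (Fin k)) :
    ∑ D ∈ decompositions (∏ i ∈ S, p i), ∑ d₀ ∈ D, ∑ d₁ ∈ D.erase d₀,
        φ d₀ * (ψ d₁ * ∏ d ∈ (D.erase d₀).erase d₁, w d) =
      ∑ B ∈ S.powerset.filter (fun B => B.Nonempty), φ (∏ i ∈ B, p i) *
        ∑ B' ∈ (S \ B).powerset.filter (fun B' => B'.Nonempty), ψ (∏ i ∈ B', p i) *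
          ∑ D ∈ decompositions (∏ i ∈ (S \ B) \ B', p i), ∏ d ∈ D, w d := by
  simp_rw [← mul_sum]
  rw [sum_decompositions_pointed_eq p hp hinj φ (fun D => ∑ d₁ ∈ D, ψ d₁ * ∏ d ∈ D.erase d₁, w d) S]
  refine sum_congr rfl fun B _ => ?_
  rw [sum_decompositions_pointed_prod_eq p hp hinj ψ w (S \ B)]

end Pointed

end Literature.NumberTheory.EllipticCurves.Smith2016
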